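import Literature.MathematicalPhysics.QuantumFieldTheory.BalabanImbrieJaffe1984to88.BIJ85SmallFieldSplit64

/-!
# `BalabanImbrieJaffe1984to88.BIJ85Eq321UnitField` — T. Bałaban, J. Imbrie, A. Jaffe, *Renormalization of the Higgs model:
minimizers, propagators and the stability of mean field theory*, Commun. Math. Phys. **97** (1985) 299–329
[BalabanImbrieJaffe1985], p. 308 [PDF 10]: the unit lattice field **(3.21)** u^{(1)} = u·exp(−ie(ε)A), typed with body

statement-level skeleton of published theorems with citation tags; proofs where landed; nothing here is a claim about the Yang–Mills mass gap

CITATION HEADER (lean-in-tree rule).  Part of the lit-balaban TYPED SKELETON (HOME `run/shared/lean/pub/lit-balaban/`), reader/typer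
seat r15 (fold owner of C1), generation 4.  Row **C1.Eq3.19-3.21** of `HOME/lit-balaban-r15/ROWS-C1.md` («(3.21) definition not
typed» — done here).  Vocabulary: r15's `BIJ85Sect1Model.U1Field` (u : bonds → U(1) ⊂ ℂ, `plaq`), and the (6.2) vocabulary of
`BIJ85SmallFieldSplit64` — the bondwise product `translate62` and u′ = exp(ieB′) `expField` — of which (3.21) is the first-step
instance with B′ = −A.

THE PRINTED TEXT (verbatim, p. 308 [PDF 10]).  *"Define the unit lattice field u^{(1)} = u exp(−ie(ε)A), (3.21) with A the
fluctuation field defined by (3.16). Then after scaling back to the L^{−1} lattice, u₁ ≡ S_L^*u^{(1)} is the gauge field on the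
L^{−1} lattice on which the unit lattice renormalized action depends."*

WHAT IS TYPED / PROVED.  `uOne eε u A` — (3.21) as a definition with body, bondwise u(b)·exp(−ie(ε)A(b)) (the coupling e(ε) =
`BIJ85Sect1Model.eEps e ε d` is passed as the real number `eε`; A is any real bond field, in the paper the fluctuation field of
(3.16), row C1.Eq3.15-3.16, `BIJ85Eq317Proof`); `uOne_eq_translate62` ((3.21) = (6.2) with u′ = exp(ie(ε)(−A)) and Q^{s*}v := u);
`uOne_zero` (no fluctuation ⇒ u^{(1)} = u); `uOne_add` (successive fluctuations compose); `plaq_uOne` (U(1) is abelian: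
u^{(1)}(∂p) = u(∂p)·exp(−ie(ε)(∂A)(p)), ∂A = `curl1 A`).  Typing note T1: "u₁ ≡ S_L^*u^{(1)}" — in the tree's convention the
lattice spacing is carried by the level/ε parameters and a U(1) bond field is dimensionless, so S_L^* does not change the VALUES
of u^{(1)} (contrast the Higgs field, `BIJ85Sect2Scaling.scaleL`, factor L^{−(d−2)/2}); u₁ is `uOne eε u A` read on the
L^{−1}-lattice and no separate declaration is made.  NOTHING beyond the kernel-checked statements below is asserted.  Unit
`lit-balaban-r15` (literature-prover-lit-balaban-r15-g4-0), 2026-08-21.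
-/

namespace Literature.MathematicalPhysics.QuantumFieldTheory.BalabanImbrieJaffe1984to88.BIJ85Eq321UnitField

open Literature.MathematicalPhysics.QuantumFieldTheory.Balaban1983to89
open BIJ85Sect1Model BIJ85SmallFieldSplit64

variable {P : Params} {j : ℕ}

/-- **(3.21)** p. 308 [PDF 10], verbatim: *"Define the unit lattice field u^{(1)} = u exp(−ie(ε)A), (3.21) with A the
fluctuation field defined by (3.16)."* — bondwise, u^{(1)}(b) = u(b)·e^{−ie(ε)A(b)} ∈ U(1).
[cite: BalabanImbrieJaffe1985, (3.21) p.308] -/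
noncomputable def uOne (eε : ℝ) (u : U1Field P j) (A : PBond P j → ℝ) : U1Field P j :=
  fun b => u b * Circle.exp (-(eε * A b))

/-- kernel: (3.21) bondwise. [cite: BalabanImbrieJaffe1985, (3.21) p.308] -/
theorem uOne_apply (eε : ℝ) (u : U1Field P j) (A : PBond P j → ℝ) (b : PBond P j) :
    uOne eε u A b = u b * Circle.exp (-(eε * A b)) := rfl

/-- kernel: (3.21) is the (6.2) translation u = u′·w with u′ = exp(ie(ε)·(−A)) and w = u (`translate62`, `expField`).
[cite: BalabanImbrieJaffe1985, (3.21) p.308] -/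
theorem uOne_eq_translate62 (eε : ℝ) (u : U1Field P j) (A : PBond P j → ℝ) :
    uOne eε u A = translate62 (expField eε (-A)) u := by
  funext b
  simp only [uOne, translate62, expField, Pi.neg_apply, mul_neg, mul_comm (u b)]

/-- kernel: without fluctuation field the unit lattice field is u itself, u^{(1)} = u at A = 0.
[cite: BalabanImbrieJaffe1985, (3.21) p.308] -/
theorem uOne_zero (eε : ℝ) (u : U1Field P j) : uOne eε u 0 = u := by
  funext b
  simp [uOne]

/-- kernel: successive fluctuation fields compose additively, (u^{(1)}[A])^{(1)}[A′] = u^{(1)}[A + A′].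
[cite: BalabanImbrieJaffe1985, (3.21) p.308] -/
theorem uOne_add (eε : ℝ) (u : U1Field P j) (A A' : PBond P j → ℝ) :
    uOne eε (uOne eε u A) A' = uOne eε u (A + A') := by
  funext b
  simp only [uOne, Pi.add_apply, mul_add, neg_add, Circle.exp_add, mul_assoc]

/-- kernel: the plaquette variables of the unit lattice field — U(1) is abelian, so u^{(1)}(∂p) = u(∂p)·exp(−ie(ε)(∂A)(p))
with the unit-spacing plaquette sum ∂A = `curl1 A` (cf. (6.4)). [cite: BalabanImbrieJaffe1985, (3.21) p.308] -/
theorem plaq_uOne (eε : ℝ) (u : U1Field P j) (A : PBond P j → ℝ) (p : Plaq P j) :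
    plaq (uOne eε u A) p = plaq u p * Circle.exp (-(eε * curl1 A p)) := by
  rw [uOne_eq_translate62, plaq_translate62, plaq_expField, mul_comm (plaq u p)]
  congr 1
  simp only [curl1, Pi.neg_apply]
  congr 1
  ring

end Literature.MathematicalPhysics.QuantumFieldTheory.BalabanImbrieJaffe1984to88.BIJ85Eq321UnitField
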